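import Mathlib
import HarnessLib
import Summits.QuantumAdvantage.QuantumAdvantage.Theses.SymplecticPurity

/-!
# Sketch — crux-ideate stmt-QuantumAdvantage-10730 (CompositeFrameBound), ideator 3, round 1

First lemmas of the idea cards `Ideas/gaussian-orbit-flatness.md` and
`Ideas/third-level-conjugation.md`.  Nothing here is proved; the statements must elaborate.
-/

noncomputable section

namespace Summit.QuantumAdvantage.QuantumAdvantage.Cruxes.CompositeFrameBound.Sketch

open scoped Matrix
open Literature.Computability.Cryptography Literature.Computability.QuantumComplexity
open Summit.QuantumAdvantage.QuantumAdvantage.Theses.SymplecticPurity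

/-- The normalised cube graph state `ĝ = 2^{-n/2} Σ_x |x⟩|e((e⁻¹ x)³)⟩` on `n+n` qubits, with the
crux's own binder conventions (data register `castAdd`, value register `natAdd`). -/
def cubeState (n : ℕ) (K : Type) [Field K] [Fintype K] (e : K ≃+ (Fin n → ZMod 2)) :
    QReg (n + n) → ℂ :=
  fun w => if (fun j : Fin n => w (Fin.natAdd n j)) =
      (fun j : Fin n => decide (e ((e.symm (fun i : Fin n => if w (Fin.castAdd n i) then 1 else 0)) ^ 3) j = 1))
    then ((Real.sqrt 2 ^ n)⁻¹ : ℂ) else 0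

/-- Semantic Clifford unitary on `N` qubits (as in items 10729/10730): unitary and Pauli-normalising
up to a unit phase. -/
def IsCliffordU (N : ℕ) (U : Matrix (QReg N) (QReg N) ℂ) : Prop :=
  U ∈ Matrix.unitaryGroup (QReg N) ℂ ∧
    ∀ S : Fin N → Pauli, ∃ S' : Fin N → Pauli, ∃ c : ℂ, ‖c‖ = 1 ∧
      U * pauliString S * star U = c • pauliString S'

/-- Fermionic Gaussian unitary on `N` qubits w.r.t. the tree's Jordan–Wigner `majorana`
(as in items 9838/10730): `U c_p U† = Σ_q R_pq c_q` with `R Rᵀ = 1`. -/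
def IsGaussianU (N : ℕ) (U : Matrix (QReg N) (QReg N) ℂ) : Prop :=
  U ∈ Matrix.unitaryGroup (QReg N) ℂ ∧
    ∃ R : Matrix (Fin N × Bool) (Fin N × Bool) ℝ, R * Rᵀ = 1 ∧
      ∀ p : Fin N × Bool, U * majorana N p.1 p.2 * star U =
        ∑ q : Fin N × Bool, (R p q : ℂ) • majorana N q.1 q.2

/-- `ε`-flatness of the Pauli spectrum of a vector. -/
def IsFlat (N : ℕ) (ε : ℝ) (ψ : QReg N → ℂ) : Prop :=
  ∀ S : Fin N → Pauli, S ≠ (fun _ => Pauli.I) → ‖star ψ ⬝ᵥ (pauliString S).mulVec ψ‖ ≤ ε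

/-- **Card `gaussian-orbit-flatness`, transfer statement C⁺ = (★) `CompositeFlat`.**
One Gaussian rotation in ANY Clifford-conjugate Majorana frame keeps the cube state exponentially
Pauli-flat: for all Clifford `U₁` and Gaussian `U` on `n+n` qubits, `U (U₁ ĝ)` is `2^{-cn}`-flat.
Equivalently: every rotated sub-parity `U₁† U† σ_S U U₁ = Σ_T det(R_{S,T}) c'_T` of `ĝ` is
`2^{-cn}`-unbiased, i.e. the comass of each Majorana correlation form of `U₁ĝ` is `≤ 2^{-cn}`. -/
def CompositeFlat : Prop :=
  ∃ c : ℝ, 0 < c ∧ ∃ n₀ : ℕ, ∀ n ≥ n₀, ∀ (K : Type) [Field K] [Fintype K], Fintype.card K = 2 ^ n →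
    ∀ e : K ≃+ (Fin n → ZMod 2), ∀ U₁ U : Matrix (QReg (n + n)) (QReg (n + n)) ℂ,
      IsCliffordU (n + n) U₁ → IsGaussianU (n + n) U →
        IsFlat (n + n) ((2 : ℝ) ^ (-(c * (n : ℝ)))) (U.mulVec (U₁.mulVec (cubeState n K e)))

/-- **First lemma of card `gaussian-orbit-flatness`** (pure bookkeeping, M-sized):
`(★)` and the route's support item `SymplecticPurityBound` (taken with `m = 0` ancillas, applied
to `ψ := U U₁ ĝ` and the last Clifford `U₂`) give the crux with constant `c/2`
(`4 · 2^{-cn} ≤ 2^{-cn/2}` once `n ≥ 4/c`; `tensorVec ψ (zeroState 0) = ψ` on `QReg ((n+n)+0)`). -/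
theorem compositeFrameBound_of_compositeFlat :
    CompositeFlat → SymplecticPurityBound → CompositeFrameBound := by
  sorry

/-- **Provable shell (a) of card `gaussian-orbit-flatness`: one Pauli rotation costs at most √2 in
flatness.**  `exp(iθP) = cos θ · 1 + i sin θ · P` for a Pauli string `P`; every Givens factor
`exp(θ c_p c_q / 2)` of a Gaussian unitary is of this form (`i c_p c_q` is a Pauli string up to
sign), so a Gaussian with `g` non-Clifford Givens factors maps an `ε`-flat state to a
`2^{g/2} ε`-flat one. -/
theorem isFlat_pauliRotation (N : ℕ) (ε θ : ℝ) (ψ : QReg N → ℂ) (P : Fin N → Pauli)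
    (hψ : normSq ψ = 1) (hflat : IsFlat N ε ψ) :
    IsFlat N (Real.sqrt 2 * ε)
      ((((Real.cos θ : ℂ)) • (1 : Matrix (QReg N) (QReg N) ℂ) +
        ((Real.sin θ : ℂ) * Complex.I) • pauliString P).mulVec ψ) := by
  sorry

/-- **Provable shell (b): extreme Majorana degrees.**  For a Gaussian `U` with rotation `R` and a
Pauli `σ_S = (phase) · c_T₀` of Majorana degree `d = |T₀|`, `U† σ_S U = Σ_{|T|=d} det(R_{T₀,T}) c_T`
and `Σ_T |det R_{T₀,T}| ≤ √(C(2N,d))` (Cauchy–Schwarz + Cauchy–Binet), so an `ε`-flat `ψ` has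
`|⟨Uψ| σ_S |Uψ⟩| ≤ √(C(2N,d)) · ε`.  Stated for the degree read off through an explicit monomial. -/
theorem flat_after_gaussian_low_degree (N d : ℕ) (ε : ℝ) (ψ : QReg N → ℂ)
    (U : Matrix (QReg N) (QReg N) ℂ) (hU : IsGaussianU N U) (hψ : normSq ψ = 1)
    (hflat : IsFlat N ε ψ) (S : Fin N → Pauli) (t : Fin d → Fin N × Bool)
    (ht : StrictMono fun i => 2 * (t i).1.val + (if (t i).2 then 1 else 0))
    (c : ℂ) (hc : ‖c‖ = 1)
    (hS : pauliString S = c • (List.ofFn t).foldr (fun p M => majorana N p.1 p.2 * M) 1)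
    (hd : 0 < d) :
    ‖star (U.mulVec ψ) ⬝ᵥ (pauliString S).mulVec (U.mulVec ψ)‖ ≤ Real.sqrt ((2 * N).choose d) * ε := by
  sorry

/-- **First lemma of card `third-level-conjugation`: the cube data-loader is third-level.**
The permutation unitary `P_F : |x⟩|y⟩ ↦ |x⟩|y ⊕ e((e⁻¹x)³)⟩` conjugates every Pauli string to a
(semantic) Clifford unitary — because `x ↦ x³ = x · x²` is QUADRATIC over `𝔽₂` (Gold exponent
`2¹+1`), its derivatives `D_a x³ = a x² + a² x + a³` are affine, so `P_F X_i P_F† = X_i ⊗ (affine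
CNOT network)` and `P_F Z_j^{(y)} P_F† = Z_j^{(y)} · (-1)^{q_j(x)}` with `q_j` quadratic (a CZ/S
diagonal Clifford).  Hence `ĝ = P_F |+ⁿ 0ⁿ⟩` is a `C₃`-state and every rotated monomial of the crux,
conjugated by `U₁ P_F`, is a Gaussian-type combination `Σ_T det(R_{S,T}) Ĉ_T` of monomials in a
CLIFFORD-VALUED anticommuting frame `Ĉ_p := P_F† c'_p P_F`, evaluated in a STABILIZER state. -/
theorem cubeLoader_thirdLevel (n : ℕ) (K : Type) [Field K] [Fintype K]
    (hK : Fintype.card K = 2 ^ n) (e : K ≃+ (Fin n → ZMod 2)) :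
    let f : QReg n → QReg n := fun x j =>
      decide (e ((e.symm (fun i : Fin n => if x i then 1 else 0)) ^ 3) j = 1)
    let PF : Matrix (QReg (n + n)) (QReg (n + n)) ℂ := Matrix.of fun w w' =>
      if (fun i : Fin n => w (Fin.castAdd n i)) = (fun i : Fin n => w' (Fin.castAdd n i)) ∧
         (fun j : Fin n => w (Fin.natAdd n j)) =
           (fun j : Fin n => Bool.xor (w' (Fin.natAdd n j)) (f (fun i => w' (Fin.castAdd n i)) j))
      then 1 else 0
    ∀ S : Fin (n + n) → Pauli, IsCliffordU (n + n) (PF * pauliString S * star PF) := by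
  sorry

/-- **Card `third-level-conjugation`, transfer statement C⁺⁺ `StabilizerFrameFlat`** (implies
`CompositeFlat` by the conjugation identity `⟨ĝ| U₁†U†σ_S U U₁ |ĝ⟩ = ⟨+ⁿ0ⁿ| P_F† U₁† U† σ_S U U₁ P_F |+ⁿ0ⁿ⟩`
and `IsCliffordU`-closure under products): for every family of `2N` pairwise ANTICOMMUTING
Hermitian semantic-Clifford involutions `Ĉ_p` on `N = n+n` qubits whose non-empty ordered
monomials are all `ε`-unbiased on the stabilizer state `|+ⁿ 0ⁿ⟩` with `ε = 2^{1-n/2}` AND which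
arise as `P_F† (Clifford frame) P_F` — every real-orthogonal recombination
`Σ_T det(R_{S,T}) Ĉ_T` is `2^{-cn}`-unbiased on `|+ⁿ0ⁿ⟩`.  (Typed here in its concrete form:
flatness of `U U₁ P_F |+ⁿ0ⁿ⟩`, which is literally `CompositeFlat` with `ĝ` unfolded; the abstract
Clifford-valued-frame form is the line's working hypothesis, see the card.) -/
def StabilizerFrameFlat : Prop := CompositeFlat

end Summit.QuantumAdvantage.QuantumAdvantage.Cruxes.CompositeFrameBound.Sketch
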